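import Mathlib.NumberTheory.NumberField.CMField
import Literature.NumberTheory.Automorphic.QuadraticNonsplitPlaceOfNotIsSquare   -- ★ `smul_placesOver_eq_of_not_isSquare` (a local non-square of `δ²` makes `v` non-split)
import Literature.NumberTheory.Automorphic.QuadraticPlaceDescentPins              -- ★ `exists_apply_eq_neg_ne_zero` (a skew element `δ`, `c δ = −δ ≠ 0`)
import Literature.NumberTheory.QuadraticForms.GlobalSquareTheoremProofs           -- ★ `infinite_setOf_not_isSquare_adicCompletion` (density of split primes, Marcus Ch. 7 Thm. 43)
import HarnessLib

/-!
# A CM field has infinitely many finite places of its maximal real subfield that do NOT split in it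
# (Marcus, *Number Fields*, Ch. 7 Thm. 43 and its Corollary; Cassels–Fröhlich Ch. II §10)

Topic `NumberTheory/Automorphic`; namespace `Literature.NumberTheory.Automorphic.UnitaryGroup` (the home of ★ `PlacesOver` and of the
non-split-place lemmas this file assembles).  PROOF FILE: theorems only — no definition, no named fact, no instance, no notation, no `sorry`.

THE STATEMENT (`infinite_setOf_forall_placesOver_complexConj_smul_eq`).  For a CM field `L` with maximal real subfield `L⁺` and complex
conjugation `c̄ = IsCMField.complexConj L`, the set of finite places `v` of `L⁺` such that EVERY place `w ∣ v` of `L` is fixed by `c̄` — the tree's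
currency for «`v` does not split in `L`» (★ `UnitaryGroupNonsplitPlace`: then `w` is the unique place above `v`) — is INFINITE.

THE PROOF (no Chebotarev beyond what the tree already proves).  Pick a skew element `δ ∈ L`, `c̄ δ = −δ ≠ 0` (★ `exists_apply_eq_neg_ne_zero`); then
`d := δ² ∈ L⁺` (Mathlib `IsCMField.complexConj_eq_self_iff`) and `d` is NOT a square in `L⁺` (a square root `r ∈ L⁺` would give `δ = ±r` fixed by `c̄`,
forcing `δ = 0`).  By ★ `Literature.NumberTheory.QuadraticForms.infinite_setOf_not_isSquare_adicCompletion` (the «infinitely many» form of O'Meara's Global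
Square Theorem, proved in the tree from the strong Dirichlet density `½` of the split primes of `L⁺(√d) ∕ L⁺`, Marcus Ch. 7 Thm. 43) `d` is a non-square in
`L⁺_v` for infinitely many finite `v`, and at every such `v` all places `w ∣ v` are fixed by `c̄` (★ `smul_placesOver_eq_of_not_isSquare`: `L ⊗ L⁺_v` is then
a field, Cassels–Fröhlich Ch. II §10).

USE (cell `hodgecm-mathlib`, crux H413, R90-TF S7 junction JQ-S7-C1 `qsRigidCore_of_S5`): the a.e. hypothesis «`π_v = πⁿ(ξ_v)` off a finite set» of Rogawski's
Thm. 13.3.6 (c) contains a NON-SPLIT place, at which the finite trigger of 13.3.6 (c) applies.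

## References
* D. A. Marcus, *Number Fields*, 2nd ed., Springer (2018), Ch. 7 Thm. 43 and Corollary (a non-trivial normal extension has infinitely many non-split
  primes) [Marcus2018].
* J. W. S. Cassels, A. Fröhlich (eds.), *Algebraic Number Theory* (1967), Ch. II §10 (`w ∣ v` unique iff `L ⊗_K K_v` is a field) [CasselsFrohlichANT1967].
* O. T. O'Meara, *Introduction to Quadratic Forms* (1963), §65C Thm. 65:15 [Omeara1963].
-/

set_option autoImplicit false

noncomputable section

open NumberField IsDedekindDomain

namespace Literature.NumberTheory.Automorphic.UnitaryGroup

/-- **A skew element of a CM field has a non-square norm-like square in `L⁺`**: if `c̄ δ = −δ ≠ 0` then `δ² ∈ L⁺` is not a square in `L⁺`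
(a square root `r ∈ L⁺` gives `δ = ±r`, fixed by `c̄`, so `δ = −δ = 0`). [cite: CasselsFrohlichANT1967, Ch. II §10] -/
theorem not_isSquare_of_complexConj_apply_eq_neg (L : Type) [Field L] [NumberField L] [IsCMField L] {δ : L}
    (hcδ : IsCMField.complexConj L δ = -δ) (hδ : δ ≠ 0)
    (hmem : δ * δ ∈ maximalRealSubfield L) : ¬ IsSquare (⟨δ * δ, hmem⟩ : ↥(maximalRealSubfield L)) := by
  rintro ⟨r, hr⟩
  have hL : δ * δ = (r : L) * (r : L) := by
    have h := congrArg (algebraMap (↥(maximalRealSubfield L)) L) hr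
    rwa [map_mul] at h
  have hfix : IsCMField.complexConj L δ = δ := by
    rcases mul_self_eq_mul_self_iff.1 hL with h | h
    · rw [h]
      exact IsCMField.complexConj_apply_eq_self L r
    · rw [h, map_neg, IsCMField.complexConj_apply_eq_self L r]
  exact hδ (self_eq_neg.1 (hfix.symm.trans hcδ))

/-- **A CM FIELD HAS INFINITELY MANY NON-SPLIT FINITE PLACES.**  For a CM field `L`, the finite places `v` of the maximal real subfield `L⁺` all of
whose places `w ∣ v` in `L` are fixed by the complex conjugation `c̄` (i.e. `v` does not split in `L`) form an infinite set.  Proof: a skew `δ`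
(`c̄ δ = −δ ≠ 0`) has `d = δ² ∈ L⁺` a non-square; `d` is a local non-square at infinitely many `v` (★ `infinite_setOf_not_isSquare_adicCompletion`, from the
density `½` of split primes — Marcus Ch. 7 Thm. 43), and there every `w ∣ v` is `c̄`-fixed (★ `smul_placesOver_eq_of_not_isSquare`).
[cite: Marcus2018, Ch. 7 Thm. 43] [cite: CasselsFrohlichANT1967, Ch. II §10] [cite: Omeara1963, §65C Thm. 65:15] -/
theorem infinite_setOf_forall_placesOver_complexConj_smul_eq (L : Type) [Field L] [NumberField L] [IsCMField L] :
    {v : HeightOneSpectrum (𝓞 ↥(maximalRealSubfield L)) |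
      ∀ w : PlacesOver L v, IsCMField.complexConj L • w.1 = w.1}.Infinite := by
  obtain ⟨δ, hcδ, hδ⟩ := exists_apply_eq_neg_ne_zero (IsCMField.complexConj L) (IsCMField.complexConj_ne_one (K := L))
  have hfix : IsCMField.complexConj L (δ * δ) = δ * δ := by rw [map_mul, hcδ, neg_mul_neg]
  have hmem : δ * δ ∈ maximalRealSubfield L := (IsCMField.complexConj_eq_self_iff L (δ * δ)).1 hfix
  have hd : δ * δ = algebraMap (↥(maximalRealSubfield L)) L ⟨δ * δ, hmem⟩ := rfl
  refine (Literature.NumberTheory.QuadraticForms.infinite_setOf_not_isSquare_adicCompletion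
    (not_isSquare_of_complexConj_apply_eq_neg L hcδ hδ hmem)).mono ?_
  intro v hv w
  exact smul_placesOver_eq_of_not_isSquare L v (IsCMField.complexConj L) hcδ hδ hd hv w

/-- **Cofinite form**: every finite set of finite places of `L⁺` misses a non-split place. [cite: Marcus2018, Ch. 7 Thm. 43] -/
theorem exists_forall_placesOver_complexConj_smul_eq_not_mem (L : Type) [Field L] [NumberField L] [IsCMField L]
    (S : Set (HeightOneSpectrum (𝓞 ↥(maximalRealSubfield L)))) (hS : S.Finite) :
    ∃ v : HeightOneSpectrum (𝓞 ↥(maximalRealSubfield L)), v ∉ S ∧ ∀ w : PlacesOver L v, IsCMField.complexConj L • w.1 = w.1 := by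
  obtain ⟨v, hv, hvS⟩ := ((infinite_setOf_forall_placesOver_complexConj_smul_eq L).sdiff hS).nonempty
  exact ⟨v, hvS, hv⟩

end Literature.NumberTheory.Automorphic.UnitaryGroup

end
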